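import Summits.Ventures.GridStability.Models.GFMSMIBTwinVICCT

/-!
# GridStability/Models/GFMSMIBTwinVIRelease — the twin with its virtual impedance, RELEASED at any instant: every bolted fault of duration ≤ 0.44 s is recovered to the operating point `(δˢ, 0)` whatever the VI release instant (phases 3–4 of Qoria's Fig. V-13 with inertial effect), 0 kit

Cell `gridfusion` (LADDER-GRIDFUSION rung G3.a, thread «G3.a-cct»; seat gridfusion-model-3 (g10)); companion of
`GFMSMIBTwinVICCT.lean` (`twinVI_cct_lower`: for `T ≤ 11/25` s the VI-LATCHED post-fault motion `Y` stays in the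
VI energy well `{V_VI ≤ 9/20}` and relocks at the VI-curve rest angle).  The print's recovery [cite: Qoria2020,
§V.3.2 Fig. V-13 phases 3–4; §V.3.6 «`t_c = 498` ms with `H_VSC = 5` s», Fig. V-19/V-20] releases the VI when the
current falls back (phase 4) and the converter returns to the ORIGINAL operating point.  THIS FILE certifies that
reading with the release instant as an INPUT: for every `T ≤ 11/25` s and EVERY release instant `t_d ≥ 0`, if the
converter follows the maximal-VI curve until `t_d` (state `Y t_d` of the latched motion) and the unlimited curve
(the twin `gfmQoriaV5sPhys`, P_M = 4) from that state on, then it keeps the unlimited window, energy `≤ 6.4917`,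
and tends to `(δˢ, 0)` (`twinVI_release_returns`).  KEY LEMMA `unl_energy_le_of_vi_well`: the VI well at
level `9/20` lies INSIDE the unlimited energy well — on `{V_VI ≤ 9/20} ∩ {δ′ ∈ (−π − δ₁″, π − δ₁″)}` the shifted
angle is confined to `[−0.30, 2.21]` (VI potential antitone/monotone around `δ₁″`, `V_PE,VI(−0.30), V_PE,VI(2.21)
> 9/20`), where the unlimited energy is `≤ 9/20 + max(V_PE(−0.4554), V_PE(2.0547)) ≤ 9/20 + 4.89 < 6.4917 <
V_cr` (model-1 `twin_criticalEnergy_gt`); then #114's energy route (`energyWell_roa_Ici`).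
THREE COLUMNS.  CERTIFIED: «MODEL M_twin+VI→M_twin (maximal-VI curve on `[0, t_d]`, unlimited curve after, any
`t_d ≥ 0`; bolted terminal fault from `(δˢ, 0)`; MV-6D + MV-P + MV-Ω + P-INV-7/8/9/10): every fault cleared at
`T ≤ 0.44` s is recovered to `(δˢ, 0)` without pole slip» — with `GFMSMIBTwinVICCT`: `0.44 s ≤ CCT ≤ 0.58 s`
(upper side with the VI latched).  VALIDATED: RK4 `0.517 s` (latched or released), PRINTED `498 ms`.  MODELLED:
which instant releases the VI is the real control's ((V-6), current magnitude), outside the model; nothing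
about a device.
-/

noncomputable section

open Real Set Filter Topology
open Summit.Ventures.GridStability.Models.AngleEnclosure

namespace Summit.Ventures.GridStability.Models.SMIB

open InverterDroop InverterDroop.qoriaV3p08

/-! ## §1 The two potentials around their rest angles -/

/-- The VI potential is antitone on `(−π − δ₁″, δ₁″]` (derivative `A″(sin x − sin δ₁″) ≤ 0` there). [folklore] -/
theorem twinVI_potential_antitoneOn_left :
    AntitoneOn (gfmQoriaV5sVI.toLit.potentialEnergy twinVI_δ1) (Ioc (-π - twinVI_δ1) twinVI_δ1) := by
  set p := gfmQoriaV5sVI.toLit with hp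
  have hδ1 := twinVI_δ1_mem
  apply antitoneOn_of_hasDerivWithinAt_nonpos (convex_Ioc _ _)
  · exact fun x _ => (p.hasDerivAt_potentialEnergy twinVI_δ1 x).continuousAt.continuousWithinAt
  · exact fun x _ => (p.hasDerivAt_potentialEnergy twinVI_δ1 x).hasDerivWithinAt
  · intro x hx
    rw [interior_Ioc] at hx
    have h1 : sin (-twinVI_δ1) < sin (-x) :=
      ScalarFlow.sin_lt_sin_of_mem_window (δ₀ := -twinVI_δ1) ⟨by linarith [hδ1.2], by linarith [hδ1.1]⟩
        ⟨by linarith [hx.2], by linarith [hx.1]⟩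
    rw [sin_neg, sin_neg] at h1
    have hA := twinVI_Z_pos.2
    rw [hp, gfmQoriaV5sVI_toLit]
    dsimp only
    rw [← sin_twinVI_δ1]
    nlinarith

/-- The VI potential is non-negative on the VI window (minimum `0` at `δ₁″`). [folklore] -/
theorem twinVI_potential_nonneg {x : ℝ} (hx : x ∈ Ioo (-π - twinVI_δ1) (π - twinVI_δ1)) :
    0 ≤ gfmQoriaV5sVI.toLit.potentialEnergy twinVI_δ1 x := by
  set p := gfmQoriaV5sVI.toLit with hp
  have h0 : p.potentialEnergy twinVI_δ1 twinVI_δ1 = 0 := p.potentialEnergy_self twinVI_δ1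
  have hδ1 := twinVI_δ1_mem
  rcases le_total x twinVI_δ1 with hle | hge
  · have := twinVI_potential_antitoneOn_left ⟨hx.1, hle⟩ ⟨by linarith [pi_pos], le_rfl⟩ hle
    rw [← hp] at this; linarith
  · have heq : p.IsEquilibriumAngle twinVI_δ1 :=
      (toLit_isEquilibriumAngle_iff gfmQoriaV5sVI_γ twinVI_δ1).2 gfmQoriaV5sVI_isEquilibrium
    have hA : 0 ≤ p.Pmax := by rw [hp, gfmQoriaV5sVI_toLit]; exact twinVI_Z_pos.2.le
    have := p.potentialEnergy_monotoneOn_arc hA heq hδ1.1.le hδ1.2.le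
      ⟨le_rfl, by linarith [pi_gt_three, hδ1.2]⟩ ⟨hge, hx.2.le⟩ hge
    linarith

/-- The UNLIMITED twin potential `g(δ) = −P_m′(δ − δˢ) − 4 cos δ` is antitone on `[−1, δˢ]`
(companion of `qv4_potential_monotoneOn`; derivative `−P_m′ + 4 sin δ = 4(sin δ − sin δˢ) ≤ 0`). [folklore] -/
theorem qv4_potential_antitoneOn :
    AntitoneOn (fun δ => -(8290560 / 16581121 : ℝ) * (δ - deltaQV4) - 4 * cos δ) (Icc (-1) deltaQV4) := by
  have hδs1 := deltaQV4_pos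
  have hδs2 := deltaQV4_lt_pi_div_two
  refine antitoneOn_of_deriv_nonpos (convex_Icc _ _) (by fun_prop) (by fun_prop) fun δ hδ => ?_
  rw [interior_Icc] at hδ
  have hsin : sin δ ≤ sin deltaQV4 :=
    sin_le_sin_of_le_of_le_pi_div_two (by linarith [pi_gt_three, hδ.1]) hδs2.le hδ.2.le
  rw [sin_deltaQV4] at hsin
  have hd : deriv (fun δ => -(8290560 / 16581121 : ℝ) * (δ - deltaQV4) - 4 * cos δ) δ
      = -(8290560 / 16581121 : ℝ) + 4 * sin δ := by
    have h1 : HasDerivAt (fun δ => -(8290560 / 16581121 : ℝ) * (δ - deltaQV4) - 4 * cos δ)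
        (-(8290560 / 16581121 : ℝ) * 1 - 4 * (-sin δ)) δ :=
      (((hasDerivAt_id δ).sub_const deltaQV4).const_mul _).sub ((hasDerivAt_cos δ).const_mul 4)
    rw [h1.deriv]; ring
  rw [hd]
  norm_num [sQV4] at hsin ⊢
  linarith

/-! ## §2 The VI well lies inside the unlimited well -/

/-- **KEY LEMMA.**  On the VI window with `V_VI ≤ 9/20`, the shifted angle lies in `[−0.30, 2.21]`, the converter
angle `δ = δ′ − φ′` in `(−π − δˢ, π − δˢ)`, and the UNLIMITED twin energy is `≤ 6.4917`
(`≤ 9/20 + max(V_PE(−0.4554), V_PE(2.0547)) ≤ 9/20 + 4.89`). [folklore] -/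
theorem unl_energy_le_of_vi_well {d w : ℝ} (hwin : d ∈ Ioo (-π - twinVI_δ1) (π - twinVI_δ1))
    (hV : gfmQoriaV5sVI.energy twinVI_δ1 (d, w) ≤ 9 / 20) :
    d - qoriaV3VI_φ ∈ Ioo (-π - deltaQV4) (π - deltaQV4) ∧
      gfmQoriaV5sPhys.energy deltaQV4 (d - qoriaV3VI_φ, w) ≤ 64917 / 10000 := by
  set p := gfmQoriaV5sVI.toLit with hp
  have hpv : p = ⟨113 / 3550, 113 / 1420, twinVI_A * twinVI_s1, twinVI_A⟩ := gfmQoriaV5sVI_toLit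
  obtain ⟨hd1, hd2⟩ := twinVI_δ1_bounds
  obtain ⟨hφ1, hφ2⟩ := φ_bounds
  have hδs1 := deltaQV4_gt
  have hδs2 := deltaQV4_lt
  have hA := twinVI_Z_pos.2
  -- split the VI energy
  have hE : gfmQoriaV5sVI.energy twinVI_δ1 (d, w)
      = (113 : ℝ) / 3550 * w ^ 2 / 2 + p.potentialEnergy twinVI_δ1 d := by
    rw [← toLit_energy gfmQoriaV5sVI_γ, ← hp]
    unfold Literature.MathematicalPhysics.PowerSystems.SMIB.energy
    rw [hpv]; ring
  rw [hE] at hV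
  have hpot0 := twinVI_potential_nonneg hwin
  rw [← hp] at hpot0
  have hKE : (113 : ℝ) / 3550 * w ^ 2 / 2 ≤ 9 / 20 := by linarith
  have hpot : p.potentialEnergy twinVI_δ1 d ≤ 9 / 20 := by nlinarith [sq_nonneg w]
  -- the VI potential at the two fences exceeds 9/20
  have hpotval : ∀ x : ℝ, p.potentialEnergy twinVI_δ1 x
      = -(twinVI_A * twinVI_s1) * (x - twinVI_δ1) - twinVI_A * (cos x - twinVI_c1) := by
    intro x
    rw [hpv]
    unfold Literature.MathematicalPhysics.PowerSystems.SMIB.potentialEnergy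
    rw [cos_twinVI_δ1]
  have hright : d ≤ 221 / 100 := by
    by_contra hlt
    push Not at hlt
    have heq : p.IsEquilibriumAngle twinVI_δ1 :=
      (toLit_isEquilibriumAngle_iff gfmQoriaV5sVI_γ twinVI_δ1).2 gfmQoriaV5sVI_isEquilibrium
    have hmono := p.potentialEnergy_monotoneOn_arc (by rw [hpv]; exact hA.le) heq twinVI_δ1_mem.1.le
      twinVI_δ1_mem.2.le (show (221 / 100 : ℝ) ∈ Icc twinVI_δ1 (π - twinVI_δ1) from
        ⟨by linarith, by linarith [pi_gt_d2]⟩) ⟨by linarith, hwin.2.le⟩ hlt.le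
    have hcos : cos (221 / 100 : ℝ) ≤ cosUpper4 (221 / 100) :=
      cos_le_cosUpper4 (by norm_num) (by linarith [pi_gt_three])
    have hval := hpotval (221 / 100)
    rw [hval] at hmono
    simp only [twinVI_A, twinVI_Z, twinVI_s1, twinVI_c1] at hmono
    norm_num [dbl, cosUpper4] at hcos hmono hd1 hd2 hpot
    nlinarith
  have hleft : -(3 / 10) ≤ d := by
    by_contra hlt
    push Not at hlt
    have hanti := twinVI_potential_antitoneOn_left ⟨hwin.1, by linarith⟩
      (show (-(3 / 10) : ℝ) ∈ Ioc (-π - twinVI_δ1) twinVI_δ1 from ⟨by linarith [pi_gt_three], by linarith⟩)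
      hlt.le
    rw [← hp] at hanti
    have hcos : cos (3 / 10 : ℝ) ≤ cosUpper4 (3 / 10) :=
      cos_le_cosUpper4 (by norm_num) (by linarith [pi_gt_three])
    rw [← cos_neg] at hcos
    have hval := hpotval (-(3 / 10))
    rw [hval] at hanti
    simp only [twinVI_A, twinVI_Z, twinVI_s1, twinVI_c1] at hanti
    norm_num [dbl, cosUpper4] at hcos hanti hd1 hd2 hpot
    nlinarith
  -- the converter angle and the unlimited potential there
  have hδlo : -(4554 / 10000) ≤ d - qoriaV3VI_φ := by linarith
  have hδhi : d - qoriaV3VI_φ ≤ 20547 / 10000 := by linarith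
  refine ⟨⟨by linarith [pi_gt_three], by linarith [pi_gt_three]⟩, ?_⟩
  have hpotU : -(8290560 / 16581121 : ℝ) * (d - qoriaV3VI_φ - deltaQV4) - 4 * cos (d - qoriaV3VI_φ)
      ≤ 92 / 100 := by
    rcases le_total (d - qoriaV3VI_φ) deltaQV4 with hle | hge
    · have hanti := qv4_potential_antitoneOn (show (-(4554 / 10000) : ℝ) ∈ Icc (-1) deltaQV4 from
        ⟨by norm_num, by linarith⟩) ⟨by linarith, hle⟩ hδlo
      simp only at hanti
      refine hanti.trans ?_
      have hcos : cosLower4 (4554 / 10000) ≤ cos (4554 / 10000 : ℝ) :=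
        cosLower4_le_cos _ (by norm_num [dbl]) (by norm_num [dbl]) (by norm_num [dbl]) (by norm_num [dbl])
      rw [← cos_neg] at hcos
      norm_num [dbl, cosLower4] at hcos hδs1 ⊢
      nlinarith
    · have hmono := qv4_potential_monotoneOn ⟨hge, by linarith [pi_gt_three]⟩
        (show (20547 / 10000 : ℝ) ∈ Icc deltaQV4 (π - deltaQV4) from ⟨by linarith, by linarith [pi_gt_three]⟩)
        hδhi
      simp only at hmono
      refine hmono.trans ?_
      have hcos : cosLower4 (20547 / 10000) ≤ cos (20547 / 10000 : ℝ) :=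
        cosLower4_le_cos _ (by norm_num [dbl]) (by norm_num [dbl]) (by norm_num [dbl]) (by norm_num [dbl])
      norm_num [dbl, cosLower4] at hcos hδs2 ⊢
      nlinarith
  simp only [energy, gfmQoriaV5sPhys, sub_zero, cos_deltaQV4]
  norm_num [cQV4] at hpotU ⊢
  nlinarith [hKE, hpotU]

/-! ## §3 Release at any instant ⇒ return to the operating point -/

/-- **VI released at ANY instant: recovery to `(δˢ, 0)` for every fault of duration `T ≤ 11/25` s.**  `Y` is the
VI-latched post-fault motion from the shifted fault-on state (`GFMSMIBTwinVICCT`), `t_d ≥ 0` the release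
instant, `X` the unlimited twin's motion started at the released state `Y t_d − (φ′, 0)`: `X` keeps
`δ ∈ (−π − δˢ, π − δˢ)` and energy `≤ 6.4917` for ever and tends to `(δˢ, 0)`.  MODELLED: M_twin+VI→M_twin as
in the module docstring; nothing about a device. [cite: Qoria2020, §V.3.2 Fig. V-13 (phases 3–4), §V.3.6] -/
theorem twinVI_release_returns {T : ℝ} (hT0 : 0 ≤ T) (hT : T ≤ 11 / 25) {Y : ℝ → ℝ × ℝ}
    (hY : gfmQoriaV5sVI.IsSolutionOn Y (Ici 0))
    (hY0 : Y 0 = ((twinFaultOnState T).1 + qoriaV3VI_φ, (twinFaultOnState T).2))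
    {td : ℝ} (htd : 0 ≤ td) {X : ℝ → ℝ × ℝ} (hX : gfmQoriaV5sPhys.IsSolutionOn X (Ici 0))
    (hX0 : X 0 = ((Y td).1 - qoriaV3VI_φ, (Y td).2)) :
    (∀ t, 0 ≤ t → (X t).1 ∈ Ioo (-π - deltaQV4) (π - deltaQV4) ∧
        gfmQoriaV5sPhys.energy deltaQV4 (X t) ≤ 64917 / 10000) ∧
      Tendsto X atTop (𝓝 (deltaQV4, 0)) := by
  obtain ⟨hinv, -⟩ := twinVI_cct_lower hT0 hT hY hY0
  obtain ⟨hwin, hV⟩ := hinv td htd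
  obtain ⟨hwin', hV'⟩ := unl_energy_le_of_vi_well (w := (Y td).2) hwin hV
  refine energyWell_roa_Ici (p := gfmQoriaV5sPhys) rfl (by norm_num [gfmQoriaV5sPhys])
    (by norm_num [gfmQoriaV5sPhys]) (by norm_num [gfmQoriaV5sPhys]) gfmQoriaV5sPhys_isEquilibrium
    deltaQV4_pos.le deltaQV4_lt_pi_div_two twin_criticalEnergy_gt hX ?_ ?_
  · rw [hX0]; exact hwin'
  · rw [hX0]; exact hV'

end Summit.Ventures.GridStability.Models.SMIB

end
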